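import Literature.NumberTheory.Automorphic.ArchRankOneOrbitMeasure             -- ★ (H2a) this seat: the measure identity `π_* μ = C • μ_hyp`, `U(1,1)` algebra
import Mathlib.Analysis.SpecialFunctions.PolarCoord
import Mathlib.Analysis.SpecialFunctions.Complex.Circle
import Mathlib.MeasureTheory.Integral.IntervalIntegral.Periodic
import HarnessLib

/-!
# The orbit chart of `U(1,1)`: `h·diag(a,b)·h⁻¹ = b·1 + (a−b)·P(h₁₀∕h₀₀)` and the hat-box form of the regular elliptic orbital integral,
# `∫_{U(1,1)} f(h·diag(a,b)·h⁻¹) dμ(h) = C • ∫_{s>1} ∫_{θ ∈ (0,2π]} f(b·1 + (a−b)·P(s,θ)) ds dθ`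
(HAT-BOX (H2b) — the head consumed by the rank-one limit formula FILE M; Helgason, *Groups and Geometric Analysis* (2000), Introduction §4; the hyperboloid ∕ «hat-box»
coordinates `(s,θ)` of the regular elliptic orbit: p07 (g7) census `CENSUS-ROAD-Sd-JUNCTION` d13cf214 §5)

Topic `NumberTheory/Automorphic`; namespace `Literature.NumberTheory.Automorphic.UnitaryGroup`.  THEOREMS ONLY (no `def`, no instance, no notation, no axiom, no named fact, no
`sorry`).  Cell `pub/hodgecm-mathlib`, ENGINE T1 (crux H413 = `stmt-HodgeConjecture-24833`), floor-2 road «(J-nc) in-house: DESCENT + HAT-BOX» (LEAD T8-31 (1)); author F0P3a-p07 (g7).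
THIRD of three HAT-BOX files ((H1) ★ `Analysis/Complex/UnitDiscHyperbolicMeasure`, (H2a) ★ `ArchRankOneOrbitMeasure`).

WHAT IS PROVED (`G₂ = unitaryGroupOfForm (starRingEnd ℂ) (diagonal ![1,−1]) = U(1,1)`, `π h = M_h 0 = h₁₀∕h₀₀`, `μ_hyp = (1−|w|²)⁻² dA|_𝔻`):
* §1 THE CONJUGATION FORMULA **`coe_mul_diagonal_mul_coe_inv_eq`**: `↑↑h · diag(a,b) · ↑↑h⁻¹ = b•1 + (a−b)•P(π h)` with the `J`-projector onto the positive eigenline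
  `P(w) = (1−|w|²)⁻¹ · !![1, −w̄; w, −|w|²]` (entrywise, from `h⁻¹ = J hᴴ J` and `|h₀₀|² − |h₁₀|² = 1`); `proj_chart_eq` — at `w = √((s−1)∕s)·e^{iθ}` (`s > 1`) this is
  B-p17 (g23)'s `P(s,θ) = !![s, −√(s(s−1)) e^{−iθ}; √(s(s−1)) e^{iθ}, 1−s]` VERBATIM.
* §2 THE HAT-BOX COORDINATES OF `μ_hyp`: `integral_discHyperbolicMeasure_eq_integral_polar` (Mathlib polar coordinates: `∫ F dμ_hyp = ∫_{(0,1)×(−π,π)} r(1−r²)⁻² • F(re^{iθ})`),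
  **`integral_discHyperbolicMeasure_eq_half_smul_integral_chart`** (`s = (1−r²)⁻¹`, Mathlib's Jacobian change of variables on `ℝ²`: `∫ F dμ_hyp = ½ • ∫_{(1,∞)×(−π,π)} F(√(1−s⁻¹)·e^{iθ})`
  — Archimedes' hat-box: in the height `s` the hyperbolic area is LEBESGUE), and the `θ`-window shift `integral_chart_Ioo_eq_integral_chart_Ioc` to `(0, 2π]` (through Mathlib's
  `AddCircle.measurePreserving_mk`: Lebesgue on any window of length `2π` pushes to the same measure on the circle).
* §3 THE HEAD **`exists_integral_comp_conj_diag_eq_smul_integral_chart`** (statement-first on the bus 03:13Z, consumed by FILE M `ArchRankOneLimitFormula` and by the descent (d2′)):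
  for every Haar `μ` on `U(1,1)` there is `C > 0` with, for all continuous `f : M₂(ℂ) → E`, all `a ≠ b` on the unit circle,
  `∫_{U(1,1)} f(↑↑h · diag(a,b) · ↑↑h⁻¹) dμ(h) = C • ∫_{p ∈ Ioi 1 ×ˢ Ioc 0 (2π)} f(b•1 + (a−b)•P(p.1, p.2))`.
HONEST LABEL: HC_CM is proved only modulo the printed citations until rung 0 closes; this is textbook harmonic analysis on `SU(1,1)` and pays nothing by itself.

## References
* [Helgason2000] S. Helgason, *Groups and Geometric Analysis* (AMS 2000), Introduction §4 (`D = SU(1,1)∕SO(2)`, geodesic polar coordinates, the invariant measure).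
* [Rudin1980] W. Rudin, *Function Theory in the Unit Ball of ℂⁿ* (1980), §1.4, §2.2 (integration in polar coordinates on the ball; the automorphisms `φ_a`).
* [Folland1995] G. B. Folland, *A Course in Abstract Harmonic Analysis* (1995), Thm. 2.49.
-/

set_option autoImplicit false

noncomputable section

open MeasureTheory Measure Set Filter Topology Matrix Real
open Literature.Analysis.Complex Literature.MeasureTheory.Group
open scoped ENNReal NNReal ComplexConjugate MatrixGroups

namespace Literature.NumberTheory.Automorphic.UnitaryGroup

/-! ## §1 The conjugation formula through the chart -/

section Conj

/-- **`↑↑h · diag(a,b) · ↑↑h⁻¹ = b•1 + (a−b)•P(π h)`** with `P(w) = (1−|w|²)⁻¹·!![1, −w̄; w, −|w|²]`, `π h = h₁₀∕h₀₀`: the conjugate of a diagonal matrix by `h ∈ U(1,1)` is `b` plus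
`(a−b)` times the `J`-orthogonal projector `h E₀₀ h⁻¹ = h E₀₀ J hᴴ J` onto the positive eigenline `h e₀`, and that projector depends on `h` only through the chart
(`(1−|π h|²)⁻¹ = |h₀₀|²`). [cite: Helgason2000, Introduction §4] -/
theorem coe_mul_diagonal_mul_coe_inv_eq (h : unitaryGroupOfForm (starRingEnd ℂ) (Matrix.diagonal ![(1 : ℂ), -1])) (a b : ℂ) :
    ((h : GL (Fin 2) ℂ) : Matrix (Fin 2) (Fin 2) ℂ) * Matrix.diagonal ![a, b] *
        (((h⁻¹ : unitaryGroupOfForm (starRingEnd ℂ) (Matrix.diagonal ![(1 : ℂ), -1])) : GL (Fin 2) ℂ) : Matrix (Fin 2) (Fin 2) ℂ) =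
      b • (1 : Matrix (Fin 2) (Fin 2) ℂ) + (a - b) •
        ((((1 : ℝ) - ‖discMoebius ((h : GL (Fin 2) ℂ) : Matrix (Fin 2) (Fin 2) ℂ) 0‖ ^ 2)⁻¹ : ℝ) : ℂ) •
          !![1, -conj (discMoebius ((h : GL (Fin 2) ℂ) : Matrix (Fin 2) (Fin 2) ℂ) 0);
             discMoebius ((h : GL (Fin 2) ℂ) : Matrix (Fin 2) (Fin 2) ℂ) 0, -((‖discMoebius ((h : GL (Fin 2) ℂ) : Matrix (Fin 2) (Fin 2) ℂ) 0‖ ^ 2 : ℝ) : ℂ)] := by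
  -- abbreviations for the entries of the first column and the chart value
  have h00 := apply_00_ne_zero h
  have hc00 : conj (((h : GL (Fin 2) ℂ) : Matrix (Fin 2) (Fin 2) ℂ) 0 0) ≠ 0 := (map_ne_zero _).mpr h00
  have col : conj (((h : GL (Fin 2) ℂ) : Matrix (Fin 2) (Fin 2) ℂ) 0 0) * ((h : GL (Fin 2) ℂ) : Matrix (Fin 2) (Fin 2) ℂ) 0 0 -
      conj (((h : GL (Fin 2) ℂ) : Matrix (Fin 2) (Fin 2) ℂ) 1 0) * ((h : GL (Fin 2) ℂ) : Matrix (Fin 2) (Fin 2) ℂ) 1 0 = 1 :=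
    conj_apply_mul_apply_00 (conjTranspose_mul_form_mul_eq h)
  -- the real factor `(1 − |π h|²)⁻¹ = |h₀₀|² = h̄₀₀ h₀₀`
  have hw : discMoebius ((h : GL (Fin 2) ℂ) : Matrix (Fin 2) (Fin 2) ℂ) 0 = ((h : GL (Fin 2) ℂ) : Matrix (Fin 2) (Fin 2) ℂ) 1 0 / ((h : GL (Fin 2) ℂ) : Matrix (Fin 2) (Fin 2) ℂ) 0 0 :=
    chart_eq_div h
  have hfac : ((((1 : ℝ) - ‖discMoebius ((h : GL (Fin 2) ℂ) : Matrix (Fin 2) (Fin 2) ℂ) 0‖ ^ 2)⁻¹ : ℝ) : ℂ) =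
      conj (((h : GL (Fin 2) ℂ) : Matrix (Fin 2) (Fin 2) ℂ) 0 0) * ((h : GL (Fin 2) ℂ) : Matrix (Fin 2) (Fin 2) ℂ) 0 0 := by
    have e : ((‖discMoebius ((h : GL (Fin 2) ℂ) : Matrix (Fin 2) (Fin 2) ℂ) 0‖ : ℂ) ^ 2) =
        conj (((h : GL (Fin 2) ℂ) : Matrix (Fin 2) (Fin 2) ℂ) 1 0) * ((h : GL (Fin 2) ℂ) : Matrix (Fin 2) (Fin 2) ℂ) 1 0 /
          (conj (((h : GL (Fin 2) ℂ) : Matrix (Fin 2) (Fin 2) ℂ) 0 0) * ((h : GL (Fin 2) ℂ) : Matrix (Fin 2) (Fin 2) ℂ) 0 0) := by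
      rw [← Complex.ofReal_pow, ← Complex.normSq_eq_norm_sq, Complex.normSq_eq_conj_mul_self, hw, map_div₀]
      field_simp
    push_cast
    rw [e]
    have hne : conj (((h : GL (Fin 2) ℂ) : Matrix (Fin 2) (Fin 2) ℂ) 0 0) * ((h : GL (Fin 2) ℂ) : Matrix (Fin 2) (Fin 2) ℂ) 0 0 ≠ 0 := mul_ne_zero hc00 h00
    have h2 : (1 : ℂ) - conj (((h : GL (Fin 2) ℂ) : Matrix (Fin 2) (Fin 2) ℂ) 1 0) * ((h : GL (Fin 2) ℂ) : Matrix (Fin 2) (Fin 2) ℂ) 1 0 /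
        (conj (((h : GL (Fin 2) ℂ) : Matrix (Fin 2) (Fin 2) ℂ) 0 0) * ((h : GL (Fin 2) ℂ) : Matrix (Fin 2) (Fin 2) ℂ) 0 0) =
        (conj (((h : GL (Fin 2) ℂ) : Matrix (Fin 2) (Fin 2) ℂ) 0 0) * ((h : GL (Fin 2) ℂ) : Matrix (Fin 2) (Fin 2) ℂ) 0 0)⁻¹ := by
      rw [inv_eq_one_div, sub_eq_iff_eq_add, ← add_div, eq_div_iff hne, one_mul]
      linear_combination col
    rw [h2, inv_inv]
  have hnsq : ((‖discMoebius ((h : GL (Fin 2) ℂ) : Matrix (Fin 2) (Fin 2) ℂ) 0‖ ^ 2 : ℝ) : ℂ) =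
      conj (discMoebius ((h : GL (Fin 2) ℂ) : Matrix (Fin 2) (Fin 2) ℂ) 0) * discMoebius ((h : GL (Fin 2) ℂ) : Matrix (Fin 2) (Fin 2) ℂ) 0 := by
    rw [← Complex.normSq_eq_norm_sq, Complex.normSq_eq_conj_mul_self]
  -- the row relations `h J hᴴ = J`, entrywise
  have r00 := apply_mul_conj_apply_sub h 0 0
  have r01 := apply_mul_conj_apply_sub h 0 1
  have r10 := apply_mul_conj_apply_sub h 1 0
  have r11 := apply_mul_conj_apply_sub h 1 1
  norm_num [Matrix.diagonal] at r00 r01 r10 r11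
  rw [hfac, hnsq, hw, map_div₀, coe_inv_eq_form_mul_conjTranspose_mul_form]
  ext i j
  fin_cases i <;> fin_cases j
  · simp [Matrix.mul_apply, Fin.sum_univ_two, Matrix.diagonal, Matrix.conjTranspose_apply, Matrix.smul_apply]
    field_simp
    linear_combination b * r00
  · simp [Matrix.mul_apply, Fin.sum_univ_two, Matrix.diagonal, Matrix.conjTranspose_apply, Matrix.smul_apply]
    field_simp
    linear_combination (-b) * r01
  · simp [Matrix.mul_apply, Fin.sum_univ_two, Matrix.diagonal, Matrix.conjTranspose_apply, Matrix.smul_apply]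
    field_simp
    linear_combination b * r10
  · simp [Matrix.mul_apply, Fin.sum_univ_two, Matrix.diagonal, Matrix.conjTranspose_apply, Matrix.smul_apply]
    field_simp
    linear_combination (-b) * r11

end Conj

/-! ## §2 The hat-box coordinates of the hyperbolic measure -/

section Polar

variable {E : Type*} [NormedAddCommGroup E] [NormedSpace ℝ E]

/-- **`μ_hyp` IN POLAR COORDINATES**: `∫ F dμ_hyp = ∫_{(r,θ) ∈ (0,1)×(−π,π)} r(1−r²)⁻² • F(r e^{iθ})` for EVERY `F` (Mathlib `Complex.integral_comp_polarCoord_symm`; the density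
`(1−|w|²)⁻²` is radial). [cite: Rudin1980, §1.4] [cite: Helgason2000, Introduction §4] -/
theorem integral_discHyperbolicMeasure_eq_integral_polar (F : ℂ → E) :
    ∫ w, F w ∂discHyperbolicMeasure =
      ∫ p in Set.Ioo (0 : ℝ) 1 ×ˢ Set.Ioo (-π) π, (p.1 * ((1 - p.1 ^ 2)⁻¹) ^ 2) • F (Complex.polarCoord.symm p) := by
  -- Step 1: `μ_hyp` as a density against Lebesgue measure on `ℂ`
  have hmeas : Measurable fun w : ℂ => ENNReal.ofReal (((1 - ‖w‖ ^ 2)⁻¹) ^ 2) :=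
    ENNReal.measurable_ofReal.comp (((measurable_const.sub (measurable_norm.pow_const 2)).inv).pow_const 2)
  have h1 : ∫ w, F w ∂discHyperbolicMeasure = ∫ w, (Metric.ball (0 : ℂ) 1).indicator (fun w => (((1 - ‖w‖ ^ 2)⁻¹) ^ 2) • F w) w := by
    rw [discHyperbolicMeasure, integral_withDensity_eq_integral_toReal_smul hmeas (Filter.Eventually.of_forall fun _ => ENNReal.ofReal_lt_top),
      ← integral_indicator measurableSet_ball]
    refine integral_congr_ae (Filter.Eventually.of_forall fun w => ?_)
    by_cases hw : w ∈ Metric.ball (0 : ℂ) 1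
    · rw [Set.indicator_of_mem hw, Set.indicator_of_mem hw, ENNReal.toReal_ofReal (by positivity)]
    · rw [Set.indicator_of_notMem hw, Set.indicator_of_notMem hw]
  -- Step 2: polar coordinates
  rw [h1, ← Complex.integral_comp_polarCoord_symm, polarCoord_target]
  -- Step 3: the integrand vanishes for `r ≥ 1`
  have h3 : ∫ p in Set.Ioi (0 : ℝ) ×ˢ Set.Ioo (-π) π, p.1 • (Metric.ball (0 : ℂ) 1).indicator (fun w => (((1 - ‖w‖ ^ 2)⁻¹) ^ 2) • F w) (Complex.polarCoord.symm p) =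
      ∫ p in Set.Ioi (0 : ℝ) ×ˢ Set.Ioo (-π) π, (Set.Ioo (0 : ℝ) 1 ×ˢ Set.Ioo (-π) π).indicator
        (fun p : ℝ × ℝ => (p.1 * ((1 - p.1 ^ 2)⁻¹) ^ 2) • F (Complex.polarCoord.symm p)) p := by
    refine setIntegral_congr_fun (measurableSet_Ioi.prod measurableSet_Ioo) fun p hp => ?_
    have hr : 0 < p.1 := hp.1
    have hnorm : ‖Complex.polarCoord.symm p‖ = p.1 := by rw [Complex.norm_polarCoord_symm, abs_of_pos hr]
    by_cases hlt : p.1 < 1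
    · have hball : Complex.polarCoord.symm p ∈ Metric.ball (0 : ℂ) 1 := by rw [mem_ball_zero_iff, hnorm]; exact hlt
      have hS : p ∈ Set.Ioo (0 : ℝ) 1 ×ˢ Set.Ioo (-π) π := ⟨⟨hr, hlt⟩, hp.2⟩
      rw [Set.indicator_of_mem hball, Set.indicator_of_mem hS, hnorm, smul_smul]
    · have hball : Complex.polarCoord.symm p ∉ Metric.ball (0 : ℂ) 1 := by rw [mem_ball_zero_iff, hnorm]; exact hlt
      have hS : p ∉ Set.Ioo (0 : ℝ) 1 ×ˢ Set.Ioo (-π) π := fun h => hlt h.1.2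
      rw [Set.indicator_of_notMem hball, Set.indicator_of_notMem hS, smul_zero]
  rw [h3, setIntegral_indicator (measurableSet_Ioo.prod measurableSet_Ioo)]
  congr 1
  rw [Set.inter_eq_right.mpr (Set.prod_mono Set.Ioo_subset_Ioi_self subset_rfl)]

/-- The height substitution `r = √(1 − s⁻¹)` (`s = (1−r²)⁻¹`): its derivative. [folklore] -/
private theorem hasDerivAt_sqrt_one_sub_inv {s : ℝ} (hs : 1 < s) :
    HasDerivAt (fun s : ℝ => Real.sqrt (1 - s⁻¹)) ((s ^ 2)⁻¹ / (2 * Real.sqrt (1 - s⁻¹))) s := by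
  have hs0 : s ≠ 0 := by positivity
  have h1 : 0 < 1 - s⁻¹ := by rw [sub_pos]; exact inv_lt_one_of_one_lt₀ hs
  have hd : HasDerivAt (fun s : ℝ => 1 - s⁻¹) ((s ^ 2)⁻¹) s := by
    have e := (hasDerivAt_inv hs0).const_sub 1
    simpa using e
  exact hd.sqrt h1.ne'

/-- **ARCHIMEDES' HAT-BOX FOR THE HYPERBOLIC DISC**: in the height `s = (1−|w|²)⁻¹ ∈ (1, ∞)` and the angle, the hyperbolic measure is LEBESGUE:
`∫ F dμ_hyp = ½ • ∫_{(s,θ) ∈ (1,∞)×(−π,π)} F(√(1−s⁻¹)·e^{iθ})` for EVERY `F` (Mathlib's Jacobian change of variables on `ℝ²` for `(s,θ) ↦ (√(1−s⁻¹), θ)`: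
`r dr = ds∕(2s²)` and `(1−r²)⁻² = s²`). [cite: Helgason2000, Introduction §4] [cite: Rudin1980, §1.4] -/
theorem integral_discHyperbolicMeasure_eq_half_smul_integral_chart (F : ℂ → E) :
    ∫ w, F w ∂discHyperbolicMeasure =
      (1 / 2 : ℝ) • ∫ p in Set.Ioi (1 : ℝ) ×ˢ Set.Ioo (-π) π, F (Complex.polarCoord.symm (Real.sqrt (1 - p.1⁻¹), p.2)) := by
  rw [integral_discHyperbolicMeasure_eq_integral_polar]
  -- the substitution `Λ (s, θ) = (√(1 − s⁻¹), θ)` on `A = (1,∞) × (−π,π)` with image `(0,1) × (−π,π)`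
  have hA : MeasurableSet (Set.Ioi (1 : ℝ) ×ˢ Set.Ioo (-π) π) := measurableSet_Ioi.prod measurableSet_Ioo
  have himage : (fun p : ℝ × ℝ => (Real.sqrt (1 - p.1⁻¹), p.2)) '' (Set.Ioi (1 : ℝ) ×ˢ Set.Ioo (-π) π) = Set.Ioo (0 : ℝ) 1 ×ˢ Set.Ioo (-π) π := by
    ext ⟨r, θ⟩
    constructor
    · rintro ⟨⟨s, θ'⟩, ⟨hs, hθ⟩, hst⟩
      simp only [Prod.mk.injEq] at hst
      obtain ⟨rfl, rfl⟩ := hst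
      have hs' : (1 : ℝ) < s := hs
      have h1 : 0 < 1 - s⁻¹ := by rw [sub_pos]; exact inv_lt_one_of_one_lt₀ hs'
      refine ⟨⟨Real.sqrt_pos.mpr h1, ?_⟩, hθ⟩
      rw [Real.sqrt_lt' one_pos, one_pow]
      have : 0 < s⁻¹ := by positivity
      linarith
    · rintro ⟨⟨hr0, hr1⟩, hθ⟩
      have h1 : 0 < 1 - r ^ 2 := by nlinarith
      refine ⟨⟨(1 - r ^ 2)⁻¹, θ⟩, ⟨?_, hθ⟩, ?_⟩
      · show (1 : ℝ) < (1 - r ^ 2)⁻¹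
        rw [← one_div, lt_div_iff₀ h1]; nlinarith
      · simp only [inv_inv, sub_sub_cancel, Real.sqrt_sq hr0.le]
  have hinj : Set.InjOn (fun p : ℝ × ℝ => (Real.sqrt (1 - p.1⁻¹), p.2)) (Set.Ioi (1 : ℝ) ×ˢ Set.Ioo (-π) π) := by
    rintro ⟨s₁, θ₁⟩ ⟨hs₁, -⟩ ⟨s₂, θ₂⟩ ⟨hs₂, -⟩ heq
    simp only [Prod.mk.injEq] at heq
    obtain ⟨hsq, rfl⟩ := heq
    have hs₁' : (1 : ℝ) < s₁ := hs₁
    have hs₂' : (1 : ℝ) < s₂ := hs₂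
    have h₁ : 0 ≤ 1 - s₁⁻¹ := (sub_pos.mpr (inv_lt_one_of_one_lt₀ hs₁')).le
    have h₂ : 0 ≤ 1 - s₂⁻¹ := (sub_pos.mpr (inv_lt_one_of_one_lt₀ hs₂')).le
    have e := Real.sqrt_inj h₁ h₂ |>.mp hsq
    have : s₁ = s₂ := inv_injective (by linarith)
    rw [this]
  have hderiv : ∀ p ∈ Set.Ioi (1 : ℝ) ×ˢ Set.Ioo (-π) π, HasFDerivWithinAt (fun p : ℝ × ℝ => (Real.sqrt (1 - p.1⁻¹), p.2))
      ((((p.1 ^ 2)⁻¹ / (2 * Real.sqrt (1 - p.1⁻¹))) • ContinuousLinearMap.id ℝ ℝ).prodMap (ContinuousLinearMap.id ℝ ℝ)) (Set.Ioi (1 : ℝ) ×ˢ Set.Ioo (-π) π) p := by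
    rintro ⟨s, θ⟩ ⟨hs, -⟩
    have hs' : (1 : ℝ) < s := hs
    have h1 : HasFDerivAt (fun s : ℝ => Real.sqrt (1 - s⁻¹)) (((s ^ 2)⁻¹ / (2 * Real.sqrt (1 - s⁻¹))) • ContinuousLinearMap.id ℝ ℝ) s := by
      have e := (hasDerivAt_sqrt_one_sub_inv hs').hasFDerivAt
      refine e.congr_fderiv (ContinuousLinearMap.ext fun x => ?_)
      rw [ContinuousLinearMap.toSpanSingleton_apply]
      show x • _ = ((s ^ 2)⁻¹ / (2 * Real.sqrt (1 - s⁻¹))) • x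
      rw [smul_eq_mul, smul_eq_mul, mul_comm]
    exact (HasFDerivAt.prodMap (p := (s, θ)) h1 (hasFDerivAt_id θ)).hasFDerivWithinAt
  rw [← himage, integral_image_eq_integral_abs_det_fderiv_smul volume hA hderiv hinj, ← integral_smul]
  refine setIntegral_congr_fun hA ?_
  rintro ⟨s, θ⟩ ⟨hs, -⟩
  have hs' : (1 : ℝ) < s := hs
  have hs0 : s ≠ 0 := by positivity
  have h1 : 0 < 1 - s⁻¹ := by rw [sub_pos]; exact inv_lt_one_of_one_lt₀ hs'
  have hsqrt : 0 < Real.sqrt (1 - s⁻¹) := Real.sqrt_pos.mpr h1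
  have hdet : ((((s ^ 2)⁻¹ / (2 * Real.sqrt (1 - s⁻¹))) • ContinuousLinearMap.id ℝ ℝ).prodMap (ContinuousLinearMap.id ℝ ℝ)).det =
      (s ^ 2)⁻¹ / (2 * Real.sqrt (1 - s⁻¹)) := by
    rw [ContinuousLinearMap.det, ContinuousLinearMap.coe_prodMap, LinearMap.det_prodMap]
    simp
  dsimp only
  obtain ⟨r, hr⟩ : ∃ r : ℝ, r = Real.sqrt (1 - s⁻¹) := ⟨_, rfl⟩
  have hr0 : 0 < r := by rw [hr]; exact hsqrt
  have hr2 : 1 - r ^ 2 = s⁻¹ := by rw [hr, Real.sq_sqrt h1.le]; ring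
  rw [hdet, abs_of_pos (by positivity), smul_smul, ← hr, hr2, inv_inv]
  congr 1
  field_simp

/-- **THE ANGLE WINDOW IS IRRELEVANT**: for an integrand that is `2π`-periodic in the angle (a function of `(s, e^{iθ})`), the integral over `(1,∞) × (−π,π)` equals the
integral over `(1,∞) × (0, 2π]` (Lebesgue measure on any window of length `2π` pushes forward to the same Haar measure of the circle `ℝ ∕ 2πℤ`, Mathlib
`AddCircle.measurePreserving_mk`). [cite: Rudin1980, §1.4] [cite: Folland1995, (2.52)] -/
theorem setIntegral_Ioi_prod_window_eq [Fact (0 < 2 * π)] (G : ℝ × AddCircle (2 * π) → E)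
    (hG : AEStronglyMeasurable G ((volume.restrict (Set.Ioi (1 : ℝ))).prod (volume : Measure (AddCircle (2 * π))))) :
    ∫ p in Set.Ioi (1 : ℝ) ×ˢ Set.Ioo (-π) π, G (p.1, (p.2 : AddCircle (2 * π))) =
      ∫ p in Set.Ioi (1 : ℝ) ×ˢ Set.Ioc 0 (2 * π), G (p.1, (p.2 : AddCircle (2 * π))) := by
  -- both sides are `∫ G` against `(vol|_{(1,∞)}) ⊗ vol_{AddCircle}`
  have key : ∀ t : ℝ, ∫ p in Set.Ioi (1 : ℝ) ×ˢ Set.Ioc t (t + 2 * π), G (p.1, (p.2 : AddCircle (2 * π))) =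
      ∫ q, G q ∂((volume.restrict (Set.Ioi (1 : ℝ))).prod (volume : Measure (AddCircle (2 * π)))) := by
    intro t
    have hmp : MeasurePreserving (Prod.map (id : ℝ → ℝ) (fun θ : ℝ => (θ : AddCircle (2 * π))))
        ((volume.restrict (Set.Ioi (1 : ℝ))).prod (volume.restrict (Set.Ioc t (t + 2 * π))))
        ((volume.restrict (Set.Ioi (1 : ℝ))).prod (volume : Measure (AddCircle (2 * π)))) :=
      (MeasurePreserving.id _).prod (AddCircle.measurePreserving_mk (2 * π) t)
    rw [Measure.volume_eq_prod, ← Measure.prod_restrict, ← hmp.map_eq, integral_map hmp.aemeasurable (by rw [hmp.map_eq]; exact hG)]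
    rfl
  have h0 := key 0
  have hπ := key (-π)
  rw [zero_add] at h0
  rw [show -π + 2 * π = π by ring] at hπ
  rw [h0, ← hπ, Measure.volume_eq_prod]
  refine setIntegral_congr_set ?_
  exact Measure.set_prod_ae_eq (ae_eq_refl _) Ioo_ae_eq_Ioc

end Polar

/-! ## §3 The head: the regular elliptic orbital integral of `U(1,1)` in the hat-box chart -/

section Head

/-- `s · √(1 − s⁻¹) = √(s(s−1))` for `0 < s` (with `1 ≤ s` in the applications). [folklore] -/
private theorem mul_sqrt_one_sub_inv {s : ℝ} (hs : 0 < s) : s * Real.sqrt (1 - s⁻¹) = Real.sqrt (s * (s - 1)) := by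
  rw [← Real.sqrt_sq hs.le, ← Real.sqrt_mul (sq_nonneg s), Real.sqrt_sq hs.le]
  congr 1
  field_simp

/-- **THE PROJECTOR IN THE HAT-BOX CHART**: at the chart point `w = √(1−s⁻¹)·e^{iθ}` (`1 < s`) the `J`-projector `(1−|w|²)⁻¹·!![1, −w̄; w, −|w|²]` is B-p17 (g23)'s
`P(s,θ) = !![s, −√(s(s−1)) e^{−iθ}; √(s(s−1)) e^{iθ}, 1 − s]` (census 0d6194a2 §1). [cite: Helgason2000, Introduction §4] -/
theorem proj_chart_eq {s : ℝ} (hs : 1 < s) (θ : ℝ) :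
    ((((1 : ℝ) - ‖Complex.polarCoord.symm (Real.sqrt (1 - s⁻¹), θ)‖ ^ 2)⁻¹ : ℝ) : ℂ) •
        !![1, -conj (Complex.polarCoord.symm (Real.sqrt (1 - s⁻¹), θ));
           Complex.polarCoord.symm (Real.sqrt (1 - s⁻¹), θ), -((‖Complex.polarCoord.symm (Real.sqrt (1 - s⁻¹), θ)‖ ^ 2 : ℝ) : ℂ)] =
      !![(s : ℂ), -(Real.sqrt (s * (s - 1)) : ℂ) * Complex.exp (-(θ * Complex.I));
         (Real.sqrt (s * (s - 1)) : ℂ) * Complex.exp (θ * Complex.I), 1 - (s : ℂ)] := by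
  have hs0 : 0 < s := by linarith
  have h1 : 0 ≤ 1 - s⁻¹ := (sub_pos.mpr (inv_lt_one_of_one_lt₀ hs)).le
  have hnorm : ‖Complex.polarCoord.symm (Real.sqrt (1 - s⁻¹), θ)‖ = Real.sqrt (1 - s⁻¹) := by
    rw [Complex.norm_polarCoord_symm, abs_of_nonneg (Real.sqrt_nonneg _)]
  have hsq : ‖Complex.polarCoord.symm (Real.sqrt (1 - s⁻¹), θ)‖ ^ 2 = 1 - s⁻¹ := by rw [hnorm, Real.sq_sqrt h1]
  have hfac : ((1 : ℝ) - ‖Complex.polarCoord.symm (Real.sqrt (1 - s⁻¹), θ)‖ ^ 2)⁻¹ = s := by rw [hsq, sub_sub_cancel, inv_inv]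
  have hw : Complex.polarCoord.symm (Real.sqrt (1 - s⁻¹), θ) = (Real.sqrt (1 - s⁻¹) : ℂ) * Complex.exp (θ * Complex.I) := by
    rw [Complex.polarCoord_symm_apply, Complex.exp_mul_I, ← Complex.ofReal_cos, ← Complex.ofReal_sin]
  have hconj : conj (Complex.polarCoord.symm (Real.sqrt (1 - s⁻¹), θ)) = (Real.sqrt (1 - s⁻¹) : ℂ) * Complex.exp (-(θ * Complex.I)) := by
    rw [hw, map_mul, Complex.conj_ofReal, ← Complex.exp_conj, map_mul, Complex.conj_ofReal, Complex.conj_I, mul_neg]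
  have hprod : (s : ℂ) * (Real.sqrt (1 - s⁻¹) : ℂ) = (Real.sqrt (s * (s - 1)) : ℂ) := by exact_mod_cast mul_sqrt_one_sub_inv hs0
  rw [hfac, hsq, hconj, hw]
  ext i j
  fin_cases i <;> fin_cases j
  · simp
  · simp only [Matrix.smul_apply, Matrix.of_apply, Matrix.cons_val', Matrix.cons_val_one, Matrix.cons_val_fin_one, Matrix.cons_val_zero, smul_eq_mul,
      Fin.zero_eta, Fin.mk_one, Fin.isValue]
    rw [mul_neg, ← mul_assoc, hprod, neg_mul]
  · simp only [Matrix.smul_apply, Matrix.of_apply, Matrix.cons_val', Matrix.cons_val_one, Matrix.cons_val_fin_one, Matrix.cons_val_zero, smul_eq_mul,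
      Fin.zero_eta, Fin.mk_one, Fin.isValue]
    rw [← mul_assoc, hprod]
  · simp only [Matrix.smul_apply, Matrix.of_apply, Matrix.cons_val', Matrix.cons_val_one, Matrix.cons_val_fin_one, smul_eq_mul,
      Fin.mk_one, Fin.isValue]
    have hs0' : (s : ℂ) ≠ 0 := Complex.ofReal_ne_zero.mpr hs0.ne'
    push_cast
    field_simp
    ring

variable [MeasurableSpace (unitaryGroupOfForm (starRingEnd ℂ) (Matrix.diagonal ![(1 : ℂ), -1]))] [BorelSpace (unitaryGroupOfForm (starRingEnd ℂ) (Matrix.diagonal ![(1 : ℂ), -1]))]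

/-- **HAT-BOX, DETERMINISTIC FORM**: if `π_* μ = C • μ_hyp` (★ `exists_map_chart_eq_smul_discHyperbolicMeasure`), then for every continuous `f : M₂(ℂ) → E` and ALL `a, b ∈ ℂ`,
`∫_{U(1,1)} f(↑↑h · diag(a,b) · ↑↑h⁻¹) dμ(h) = (C∕2) • ∫_{(s,θ) ∈ (1,∞) × (0,2π]} f(b•1 + (a−b)•P(s,θ))` — the conjugation formula, the measure identity, the hat-box
coordinates and the angle-window shift composed.  No integrability ∕ compact-support hypothesis: every step is an identity of Bochner integrals for ALL integrands.
[cite: Helgason2000, Introduction §4] [cite: Rudin1980, §1.4] [cite: Folland1995, Thm. 2.49] -/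
theorem integral_comp_conj_diag_eq_smul_integral_chart {E : Type*} [NormedAddCommGroup E] [NormedSpace ℝ E] (μ : Measure (unitaryGroupOfForm (starRingEnd ℂ) (Matrix.diagonal ![(1 : ℂ), -1]))) {C : ℝ≥0}
    (hC : μ.map (fun h : unitaryGroupOfForm (starRingEnd ℂ) (Matrix.diagonal ![(1 : ℂ), -1]) => discMoebius ((h : GL (Fin 2) ℂ) : Matrix (Fin 2) (Fin 2) ℂ) 0) = C • discHyperbolicMeasure)
    (f : Matrix (Fin 2) (Fin 2) ℂ → E) (hf : Continuous f) (a b : ℂ) :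
    ∫ h : unitaryGroupOfForm (starRingEnd ℂ) (Matrix.diagonal ![(1 : ℂ), -1]), f (((h : GL (Fin 2) ℂ) : Matrix (Fin 2) (Fin 2) ℂ) * Matrix.diagonal ![a, b] *
        (((h⁻¹ : unitaryGroupOfForm (starRingEnd ℂ) (Matrix.diagonal ![(1 : ℂ), -1])) : GL (Fin 2) ℂ) : Matrix (Fin 2) (Fin 2) ℂ)) ∂μ =
      ((C : ℝ) / 2) • ∫ p in Set.Ioi (1 : ℝ) ×ˢ Set.Ioc 0 (2 * π),
        f (b • (1 : Matrix (Fin 2) (Fin 2) ℂ) + (a - b) •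
          !![(p.1 : ℂ), -(Real.sqrt (p.1 * (p.1 - 1)) : ℂ) * Complex.exp (-(p.2 * Complex.I));
             (Real.sqrt (p.1 * (p.1 - 1)) : ℂ) * Complex.exp (p.2 * Complex.I), 1 - (p.1 : ℂ)]) := by
  -- the integrand as a function of the chart value
  obtain ⟨F, hFdef⟩ : ∃ F : ℂ → E, F = fun w => f (b • (1 : Matrix (Fin 2) (Fin 2) ℂ) + (a - b) •
      (((((1 : ℝ) - ‖w‖ ^ 2)⁻¹ : ℝ) : ℂ) • !![1, -conj w; w, -((‖w‖ ^ 2 : ℝ) : ℂ)])) := ⟨_, rfl⟩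
  -- continuity of the affine projector map on the open disc, hence of `F`
  have hMat : ∀ w : ℂ, (!![1, -conj w; w, -((‖w‖ ^ 2 : ℝ) : ℂ)] : Matrix (Fin 2) (Fin 2) ℂ) =
      !![(1 : ℂ), 0; 0, 0] + (-conj w) • !![(0 : ℂ), 1; 0, 0] + w • !![(0 : ℂ), 0; 1, 0] + (-((‖w‖ ^ 2 : ℝ) : ℂ)) • !![(0 : ℂ), 0; 0, 1] := fun w => by
    ext i j
    fin_cases i <;> fin_cases j <;> simp
  have hMc : Continuous fun w : ℂ => (!![1, -conj w; w, -((‖w‖ ^ 2 : ℝ) : ℂ)] : Matrix (Fin 2) (Fin 2) ℂ) := by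
    simp only [hMat]
    exact ((continuous_const.add (Complex.continuous_conj.neg.smul continuous_const)).add (continuous_id.smul continuous_const)).add
      ((Complex.continuous_ofReal.comp (continuous_norm.pow 2)).neg.smul continuous_const)
  have hcw : ContinuousOn (fun w : ℂ => ((((1 : ℝ) - ‖w‖ ^ 2)⁻¹ : ℝ) : ℂ)) (Metric.ball (0 : ℂ) 1) := by
    have h1 : ContinuousOn (fun w : ℂ => ((1 : ℝ) - ‖w‖ ^ 2)⁻¹) (Metric.ball (0 : ℂ) 1) := by
      refine ContinuousOn.inv₀ ((continuous_const.sub (continuous_norm.pow 2)).continuousOn) fun w hw => ?_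
      have hw' : ‖w‖ < 1 := mem_ball_zero_iff.mp hw
      nlinarith [norm_nonneg w]
    exact Complex.continuous_ofReal.comp_continuousOn h1
  have hAc : ContinuousOn (fun w : ℂ => b • (1 : Matrix (Fin 2) (Fin 2) ℂ) + (a - b) •
      (((((1 : ℝ) - ‖w‖ ^ 2)⁻¹ : ℝ) : ℂ) • (!![1, -conj w; w, -((‖w‖ ^ 2 : ℝ) : ℂ)] : Matrix (Fin 2) (Fin 2) ℂ))) (Metric.ball (0 : ℂ) 1) := by
    have h2 : ContinuousOn (fun w : ℂ => ((((1 : ℝ) - ‖w‖ ^ 2)⁻¹ : ℝ) : ℂ) • (!![1, -conj w; w, -((‖w‖ ^ 2 : ℝ) : ℂ)] : Matrix (Fin 2) (Fin 2) ℂ))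
        (Metric.ball (0 : ℂ) 1) := hcw.smul hMc.continuousOn
    have h3 : ContinuousOn (fun w : ℂ => (a - b) • (((((1 : ℝ) - ‖w‖ ^ 2)⁻¹ : ℝ) : ℂ) • (!![1, -conj w; w, -((‖w‖ ^ 2 : ℝ) : ℂ)] : Matrix (Fin 2) (Fin 2) ℂ)))
        (Metric.ball (0 : ℂ) 1) := h2.const_smul (a - b)
    exact continuousOn_const.add h3
  have hFc : ContinuousOn F (Metric.ball (0 : ℂ) 1) := by
    rw [hFdef]
    exact hf.comp_continuousOn hAc
  have hFm : AEStronglyMeasurable F discHyperbolicMeasure :=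
    (hFc.aestronglyMeasurable measurableSet_ball).mono_ac (withDensity_absolutelyContinuous _ _)
  -- (1) conjugation formula
  have h1 : ∫ h : unitaryGroupOfForm (starRingEnd ℂ) (Matrix.diagonal ![(1 : ℂ), -1]), f (((h : GL (Fin 2) ℂ) : Matrix (Fin 2) (Fin 2) ℂ) * Matrix.diagonal ![a, b] *
        (((h⁻¹ : unitaryGroupOfForm (starRingEnd ℂ) (Matrix.diagonal ![(1 : ℂ), -1])) : GL (Fin 2) ℂ) : Matrix (Fin 2) (Fin 2) ℂ)) ∂μ =
      ∫ h : unitaryGroupOfForm (starRingEnd ℂ) (Matrix.diagonal ![(1 : ℂ), -1]), F (discMoebius ((h : GL (Fin 2) ℂ) : Matrix (Fin 2) (Fin 2) ℂ) 0) ∂μ := by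
    refine integral_congr_ae (Filter.Eventually.of_forall fun h => ?_)
    dsimp only
    rw [coe_mul_diagonal_mul_coe_inv_eq, hFdef]
  -- (2) the measure identity, (3) the hat-box coordinates
  rw [h1, integral_comp_chart_eq_smul_integral μ hC F hFm, integral_discHyperbolicMeasure_eq_half_smul_integral_chart, smul_smul]
  -- (4) the angle window, through the circle `ℝ ∕ 2πℤ`
  haveI : Fact (0 < 2 * π) := ⟨by positivity⟩
  obtain ⟨Gc, hGc⟩ : ∃ Gc : ℝ × AddCircle (2 * π) → E, Gc = fun q => F ((Real.sqrt (1 - q.1⁻¹) : ℂ) * ((AddCircle.toCircle q.2 : Circle) : ℂ)) := ⟨_, rfl⟩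
  have hchart : ∀ p : ℝ × ℝ, F (Complex.polarCoord.symm (Real.sqrt (1 - p.1⁻¹), p.2)) = Gc (p.1, (p.2 : AddCircle (2 * π))) := fun p => by
    rw [hGc]
    dsimp only
    rw [AddCircle.toCircle_apply_mk, Circle.coe_exp, Complex.polarCoord_symm_apply, Complex.exp_mul_I, ← Complex.ofReal_cos, ← Complex.ofReal_sin]
    congr 3 <;> field_simp
  have hGm : AEStronglyMeasurable Gc ((volume.restrict (Set.Ioi (1 : ℝ))).prod (volume : Measure (AddCircle (2 * π)))) := by
    have hιc : ContinuousOn (fun q : ℝ × AddCircle (2 * π) => (Real.sqrt (1 - q.1⁻¹) : ℂ) * ((AddCircle.toCircle q.2 : Circle) : ℂ)) (Set.Ioi (1 : ℝ) ×ˢ Set.univ) := by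
      refine ContinuousOn.mul ?_ ((continuous_subtype_val.comp AddCircle.continuous_toCircle).comp continuous_snd).continuousOn
      refine Complex.continuous_ofReal.comp_continuousOn ((continuousOn_const.sub ((continuous_fst.continuousOn).inv₀ fun q hq => ?_)).sqrt)
      have : (1 : ℝ) < q.1 := hq.1
      positivity
    have hmaps : Set.MapsTo (fun q : ℝ × AddCircle (2 * π) => (Real.sqrt (1 - q.1⁻¹) : ℂ) * ((AddCircle.toCircle q.2 : Circle) : ℂ))
        (Set.Ioi (1 : ℝ) ×ˢ Set.univ) (Metric.ball (0 : ℂ) 1) := fun q hq => by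
      have hs : (1 : ℝ) < q.1 := hq.1
      have h1 : 0 ≤ 1 - q.1⁻¹ := (sub_pos.mpr (inv_lt_one_of_one_lt₀ hs)).le
      rw [mem_ball_zero_iff, norm_mul, Complex.norm_real, Real.norm_of_nonneg (Real.sqrt_nonneg _), Circle.norm_coe, mul_one,
        Real.sqrt_lt' one_pos, one_pow]
      have : 0 < q.1⁻¹ := by positivity
      linarith
    have hGcc : ContinuousOn Gc (Set.Ioi (1 : ℝ) ×ˢ Set.univ) := by
      rw [hGc]
      exact hFc.comp hιc hmaps
    have h := hGcc.aestronglyMeasurable (μ := (volume : Measure (ℝ × AddCircle (2 * π)))) (measurableSet_Ioi.prod MeasurableSet.univ)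
    rwa [Measure.volume_eq_prod, ← Measure.restrict_prod_eq_prod_univ] at h
  simp only [hchart]
  rw [setIntegral_Ioi_prod_window_eq Gc hGm, show (C : ℝ) * (1 / 2) = (C : ℝ) / 2 by ring]
  congr 1
  refine setIntegral_congr_fun (measurableSet_Ioi.prod measurableSet_Ioc) fun p hp => ?_
  have hs : (1 : ℝ) < p.1 := hp.1
  rw [← hchart, hFdef]
  dsimp only
  rw [proj_chart_eq hs]

/-- **HAT-BOX — THE HEAD (p07 (g7) statement-first 2026-09-01 03:13Z; consumed by FILE M `ArchRankOneLimitFormula` and the descent (d2′))**: for every Haar measure `μ` on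
`U(1,1) = U(diag(1,−1))(ℂ)` there is `C > 0` such that for every continuous `f : M₂(ℂ) → E` and ALL `a, b ∈ ℂ` (in particular `a ≠ b` on the unit circle — the regular
elliptic torus elements `diag(a,b)`):
`∫_{U(1,1)} f(↑↑h · diag(a,b) · ↑↑h⁻¹) dμ(h) = C • ∫_{(s,θ) ∈ Ioi 1 ×ˢ Ioc 0 (2π)} f(b•1 + (a−b)•!![s, −√(s(s−1)) e^{−iθ}; √(s(s−1)) e^{iθ}, 1−s])`, `C` INDEPENDENT of `(f, a, b)`.
[cite: Helgason2000, Introduction §4] [cite: Rudin1980, §1.4] [cite: Folland1995, Thm. 2.49] -/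
theorem exists_integral_comp_conj_diag_eq_smul_integral_chart {E : Type*} [NormedAddCommGroup E] [NormedSpace ℝ E] (μ : Measure (unitaryGroupOfForm (starRingEnd ℂ) (Matrix.diagonal ![(1 : ℂ), -1]))) [μ.IsHaarMeasure] :
    ∃ C : ℝ, 0 < C ∧ ∀ (f : Matrix (Fin 2) (Fin 2) ℂ → E), Continuous f → ∀ (a b : ℂ),
      ∫ h : unitaryGroupOfForm (starRingEnd ℂ) (Matrix.diagonal ![(1 : ℂ), -1]), f (((h : GL (Fin 2) ℂ) : Matrix (Fin 2) (Fin 2) ℂ) * Matrix.diagonal ![a, b] *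
          (((h⁻¹ : unitaryGroupOfForm (starRingEnd ℂ) (Matrix.diagonal ![(1 : ℂ), -1])) : GL (Fin 2) ℂ) : Matrix (Fin 2) (Fin 2) ℂ)) ∂μ =
        C • ∫ p in Set.Ioi (1 : ℝ) ×ˢ Set.Ioc 0 (2 * π),
          f (b • (1 : Matrix (Fin 2) (Fin 2) ℂ) + (a - b) •
            !![(p.1 : ℂ), -(Real.sqrt (p.1 * (p.1 - 1)) : ℂ) * Complex.exp (-(p.2 * Complex.I));
               (Real.sqrt (p.1 * (p.1 - 1)) : ℂ) * Complex.exp (p.2 * Complex.I), 1 - (p.1 : ℂ)]) := by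
  obtain ⟨C, hC0, hC⟩ := exists_map_chart_eq_smul_discHyperbolicMeasure μ
  refine ⟨(C : ℝ) / 2, by positivity, fun f hf a b => ?_⟩
  exact integral_comp_conj_diag_eq_smul_integral_chart μ hC f hf a b

end Head

end Literature.NumberTheory.Automorphic.UnitaryGroup

end
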